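import Summits.CriticalPhenomena.PercolationContinuityZ3.Theorems.PercNearOneGluingNoHeavyQuantGoodSiblingsLongCore
import HarnessLib

/-!
# QUANT lane R8, T-DEC: ONLY THE TIGHT GLUED SIBLINGS COUNT — a glued sibling `R^lo[q](R^K[g])` whose mean `m = q(lo+Kg)` is `≤ 2lo` (light) or
# `≥ lo + K·x` (FLOORED: its far-giant piece has gate `γ = (m−lo)/K ≥ x`) is TAME at the floor `x`; so every one-shape forest with at most ONE
# tight sibling is SDEC for EVERY shape (any tail length `K`), with at most THREE for `lo < K ≤ 4lo`, and with any number for `K ≤ 2lo`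
# (census-1 gen 34; sharpens this seat's `sdec_shapeForests_three_long` and g32's `sdec_shapeForests_all_twoLo` by arm-1 g57's tame adjunction)

builds on p205010 (kernel theorem, internal audit signed; external expert review pending)

Support file (`--supports stmt-CriticalPhenomena-4575`), QUANT lane seat prim-quant-census-1 (gen 34); memo
`run/shared/lean/prim/quant/prim-quant-census-1/g34/FOREST3-G34.md` §2.  Theorems only (no definitions), standard axioms, no sorries.  Uses
`sdec_shapeSib` (one glued sibling alone is SDEC at `x ≤ qg`, ANY `lo, K ≥ 1`; `…QuantShapeSibling`), `sdec_shapeForest_long` / `shapeSib_facts`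
(`…QuantShapeForestLong`), `sdec_shapeForest_twoLo` (`…QuantShapeForestTwoLo`), `sdec_append_tame` / `sdec_flaw_perm` (`…QuantResidueForestsAll`) and
`sdec_append_good` (`…QuantGoodSiblingsCore`).

THE OBSERVATION.  arm-1 g57's tameness of a sibling at floor `x` asks of every charged count `h ≥ 1`: `q·mean ≤ 2h` (light) or `x(M − h) ≤ q·mean − h`
(floored).  For the glued sibling `⟨q,·,·,lo+K,{lo: 1−g, lo+K: g}⟩` the count `lo+K` is always light (`m < lo+K ≤ 2(lo+K)`) and the count `lo` is light iff
`m ≤ 2lo`, floored iff `x·K ≤ m − lo`.  So the siblings that the piece expansion must treat are exactly the TIGHT ones, `2lo < m < lo + K·x` — the heavy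
siblings whose product floor `q·g` lies within `lo(1−q)/K` of the forest floor `x` (`m ≥ lo + Kx ⟺ qg − x ≥ lo(1−q)/K`).  At the tree-OK floor
`x = min qᵢgᵢ` the minimiser is tight (if heavy); every other sibling is tight only inside that window, which closes as `q → 1`.
* **`shapeSib_tame_of_notTight`** — a non-tight glued sibling (any shape) is tame at `x`.
* **`sdec_shapeForests_of_tightCore`** — any shape `lo, K ≥ 1`: if the sub-list of tight siblings is SDEC, the whole one-shape forest is (tame adjunction).
* **`sdec_shapeForests_of_oneTight`** — ANY SHAPE `lo, K ≥ 1` (every tail length): every forest of glued siblings `R^lo(R^K)`, any parameters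
  `0 < qᵢ, gᵢ < 1`, floor `0 < x ≤ min qᵢgᵢ`, with AT MOST ONE tight sibling is SDEC — `SDEC x (ftop L) (flaw L)`.
* **`sdec_shapeForests_long_of_fewTight`** — `lo < K ≤ 4lo`: the same with at most THREE tight siblings (`sdec_shapeForest_long` on the tight core).
* **`sdec_forest_tightCore`** — THE NODE-SHAPED FORM: good siblings (tame or hull+high, any sub-trees) + glued siblings of one shape with a tight core
  of size `≤ 1` (any shape) / `≤ 3` (`lo < K ≤ 4lo`) / any (`lo < K ≤ 2lo`), in any order, are SDEC at `x`.

HONEST STATUS.  Forests with `≥ 4` tight glued siblings of a shape `K > 2lo` (coincident floors), `≥ 2` tight ones of a shape `K > 4lo`, mixed shapes,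
4-chains, … stay open; `SiblingStep`, `GluedDominatedMass`, `SDECConvClosed`, `FarTreeRow` OPEN; RATE class (log\*) / honest sentence of
`run/shared/lean/prim/quant/README.md` unchanged.  [this work].  Nothing here is cited as a published result.  The gluing rows served
[cite: KozmaNitzan2024, Conjecture 3 (p. 15)]; product measure [cite: Grimmett1999, §1.3 p. 10].
-/

noncomputable section

open scoped BigOperators

namespace Summit.CriticalPhenomena.PercolationContinuityZ3.Theorems
namespace Quant
namespace LawDec

open Finset

/-- the sub-forest law of the glued sibling of shape `(lo, K)`: `S(g) = {lo: 1−g, lo+K: g}` -/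
local notation3 "SP[" lo ", " K ", " a "]" => (fun h : ℕ => (1 - (a : ℝ)) * (if h = (lo : ℕ) then (1 : ℝ) else 0) +
  (a : ℝ) * (if h = (lo : ℕ) + (K : ℕ) then (1 : ℝ) else 0))

/-! ### Non-tight glued siblings are tame -/

/-- **a NON-TIGHT glued sibling is TAME**: `s = ⟨q,·,·,lo+K,{lo: 1−g, lo+K: g}⟩`, `0 < q, g < 1`, and NOT (`2lo < q·mean < lo + K·x`) ⟹ every charged
count `h ≥ 1` has `q·mean ≤ 2h` or `x(M − h) ≤ q·mean − h` (the count `lo+K` is always light; the count `lo` is light or floored). [this work] -/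
theorem shapeSib_tame_of_notTight (lo K : ℕ) {x : ℝ} (s : Sib)
    (hs : s.M = lo + K ∧ 0 < s.q ∧ s.q < 1 ∧ ∃ g : ℝ, 0 < g ∧ g < 1 ∧ s.ρ = SP[lo, K, g] ∧ x ≤ s.q * g)
    (hnt : ¬ (2 * (lo : ℝ) < s.q * s.mean ∧ s.q * s.mean < (lo : ℝ) + K * x)) :
    ∀ h : ℕ, 1 ≤ h → s.ρ h ≠ 0 → s.q * s.mean ≤ 2 * h ∨ x * ((s.M : ℝ) - h) ≤ s.q * s.mean - h := by
  obtain ⟨hM, hq0, hq1, g, hg0, hg1, hρ, _⟩ := hs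
  obtain ⟨_, _, _, cm⟩ := sp_laws lo K hg0.le hg1.le
  have hmean : s.mean = (lo : ℝ) + K * g := by unfold Sib.mean; rw [hM, hρ]; exact cm
  have hlo0 : (0 : ℝ) ≤ lo := Nat.cast_nonneg lo
  have hK0 : (0 : ℝ) ≤ K := Nat.cast_nonneg K
  have hKg : (K : ℝ) * g ≤ K := by nlinarith
  have hmlt : s.q * s.mean ≤ (lo : ℝ) + K := by rw [hmean]; nlinarith
  intro h _ hh
  have hat : h = lo ∨ h = lo + K := by
    by_contra hc
    push Not at hc
    apply hh; rw [hρ]; dsimp only; rw [if_neg hc.1, if_neg hc.2]; ring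
  rcases hat with hl | hl <;> rw [hl]
  · rcases not_and_or.1 hnt with h1 | h2
    · exact Or.inl (not_lt.1 h1)
    · right
      have e : x * (((lo + K : ℕ) : ℝ) - (lo : ℝ)) = (K : ℝ) * x := by push_cast; ring
      rw [hM, e]; linarith [not_lt.1 h2]
  · left; push_cast; linarith

/-! ### The tight core -/

/-- **ONLY THE TIGHT CORE COUNTS**: for any shape `lo ≥ 1`, `K`, any list `L` of glued siblings `⟨q,·,·,lo+K,{lo: 1−g, lo+K: g}⟩` with `0 < q, g < 1`,
`x ≤ qg`, `0 < x`: if the sub-list of TIGHT siblings (`2lo < q·mean < lo + K·x`) is SDEC at `x`, then `SDEC x (ftop L) (flaw L)` (the others are tame and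
are adjoined by `sdec_append_tame`; any order by `sdec_flaw_perm`). [this work] -/
theorem sdec_shapeForests_of_tightCore (lo K : ℕ) (hlo : 1 ≤ lo) {x : ℝ} (hx0 : 0 < x) (L : List Sib)
    (hL : ∀ s ∈ L, s.M = lo + K ∧ 0 < s.q ∧ s.q < 1 ∧ ∃ g : ℝ, 0 < g ∧ g < 1 ∧ s.ρ = SP[lo, K, g] ∧ x ≤ s.q * g)
    (hS : SDEC x (ftop (L.filter (fun s => decide (2 * (lo : ℝ) < s.q * s.mean ∧ s.q * s.mean < (lo : ℝ) + K * x))))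
      (flaw (L.filter (fun s => decide (2 * (lo : ℝ) < s.q * s.mean ∧ s.q * s.mean < (lo : ℝ) + K * x))))) :
    SDEC x (ftop L) (flaw L) := by
  by_cases hnil : L = []
  · subst hnil; intro q _ _ j' hj'; exact absurd hj' (Nat.not_lt_zero _)
  obtain ⟨s₀, hs₀⟩ := List.exists_mem_of_ne_nil L hnil
  have hx1 : x < 1 := by
    obtain ⟨_, hq0, hq1, g, hg0, hg1, _, hx⟩ := hL s₀ hs₀
    nlinarith
  have facts : ∀ s ∈ L, s.LawOK ∧ x * (s.M : ℝ) ≤ s.q * s.mean := fun s hs =>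
    ⟨(shapeSib_facts lo K hlo s (hL s hs)).1, (shapeSib_facts lo K hlo s (hL s hs)).2.1⟩
  have hperm : (L.filter (fun s => !decide (2 * (lo : ℝ) < s.q * s.mean ∧ s.q * s.mean < (lo : ℝ) + K * x)) ++
      L.filter (fun s => decide (2 * (lo : ℝ) < s.q * s.mean ∧ s.q * s.mean < (lo : ℝ) + K * x))).Perm L :=
    (List.perm_append_comm).trans (List.filter_append_perm _ L)
  refine sdec_flaw_perm hperm ?_
  refine sdec_append_tame hx0 hx1 _ (fun t ht => (facts t (List.mem_of_mem_filter ht)).1)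
    (fun t ht => (facts t (List.mem_of_mem_filter ht)).2) hS _ (fun s hs => (facts s (List.mem_of_mem_filter hs)).1)
    (fun s hs => (facts s (List.mem_of_mem_filter hs)).2) ?_
  intro s hs
  obtain ⟨hsL, hb⟩ := List.mem_filter.1 hs
  have hnt : ¬ (2 * (lo : ℝ) < s.q * s.mean ∧ s.q * s.mean < (lo : ℝ) + K * x) := by
    intro hc
    simp [hc.1, hc.2] at hb
  exact shapeSib_tame_of_notTight lo K s (hL s hsL) hnt

/-- a list of AT MOST ONE glued sibling (any shape `lo, K ≥ 1`, `0 < q, g < 1`, `x ≤ qg`, `0 < x`) is SDEC: `sdec_shapeSib`. [this work] -/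
theorem sdec_shapeSibs_le_one (lo K : ℕ) (hlo : 1 ≤ lo) (hK : 1 ≤ K) {x : ℝ} (hx0 : 0 < x) : ∀ L : List Sib, L.length ≤ 1 →
    (∀ s ∈ L, s.M = lo + K ∧ 0 < s.q ∧ s.q < 1 ∧ ∃ g : ℝ, 0 < g ∧ g < 1 ∧ s.ρ = SP[lo, K, g] ∧ x ≤ s.q * g) →
    SDEC x (ftop L) (flaw L)
  | [], _, _ => by intro q _ _ j' hj'; exact absurd hj' (Nat.not_lt_zero _)
  | [s], _, hL => by
    obtain ⟨hM, hq0, hq1, g, hg0, hg1, hρ, hx⟩ := hL s (by simp)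
    obtain ⟨q, x₁, n, M, ρ⟩ := s
    simp only at hM hq0 hq1 hρ hx
    subst hM
    subst hρ
    obtain ⟨_, tM, _, _⟩ := shapeSib_laws lo K hq0.le hq1.le hg0.le hg1.le
    have e1 : flaw [⟨q, x₁, n, lo + K, SP[lo, K, g]⟩] = gate SP[lo, K, g] q := funext fun h => lconv_delta_left 0 _ _ tM h
    have e2 : ftop [⟨q, x₁, n, lo + K, SP[lo, K, g]⟩] = lo + K := by show 0 + (lo + K) = lo + K; omega
    rw [e1, e2]
    exact sdec_shapeSib lo K hlo hK hx0 hq0 hq1 hg1 hx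
  | _ :: _ :: _, h2, _ => by simp at h2

/-! ### At most one tight sibling: every shape -/

/-- **EVERY ONE-SHAPE FOREST OF GLUED SIBLINGS `R^lo(R^K)` WITH AT MOST ONE TIGHT SIBLING IS SDEC — FOR EVERY SHAPE `lo, K ≥ 1` (ANY TAIL LENGTH),
ANY PARAMETERS, EVERY WIDTH, NO ORACLE.**  `L`: siblings `⟨q,·,·,lo+K,{lo: 1−g, lo+K: g}⟩`, `0 < q, g < 1`; floor `0 < x ≤ min qᵢgᵢ`;
`(L.filter (2lo < q·mean < lo + K·x)).length ≤ 1` ⟹ `SDEC x (ftop L) (flaw L)`.  (At `x = min qᵢgᵢ` only siblings with `qⱼgⱼ − x < lo(1−qⱼ)/K` can be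
tight: the generic forest has one.) [this work] -/
theorem sdec_shapeForests_of_oneTight (lo K : ℕ) (hlo : 1 ≤ lo) (hK : 1 ≤ K) {x : ℝ} (hx0 : 0 < x) (L : List Sib)
    (hL : ∀ s ∈ L, s.M = lo + K ∧ 0 < s.q ∧ s.q < 1 ∧ ∃ g : ℝ, 0 < g ∧ g < 1 ∧ s.ρ = SP[lo, K, g] ∧ x ≤ s.q * g)
    (hone : (L.filter (fun s => decide (2 * (lo : ℝ) < s.q * s.mean ∧ s.q * s.mean < (lo : ℝ) + K * x))).length ≤ 1) :
    SDEC x (ftop L) (flaw L) :=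
  sdec_shapeForests_of_tightCore lo K hlo hx0 L hL
    (sdec_shapeSibs_le_one lo K hlo hK hx0 _ hone (fun s hs => hL s (List.mem_of_mem_filter hs)))

/-! ### At most three tight siblings: `lo < K ≤ 4lo` -/

/-- **EVERY ONE-SHAPE FOREST OF GLUED SIBLINGS `R^lo(R^K)`, `lo < K ≤ 4lo`, WITH AT MOST THREE TIGHT SIBLINGS IS SDEC — ANY PARAMETERS, EVERY WIDTH,
NO ORACLE.**  As above with `(L.filter (2lo < q·mean < lo + K·x)).length ≤ 3`; the tight core (heavy) by `sdec_shapeForest_long`. [this work] -/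
theorem sdec_shapeForests_long_of_fewTight (lo K : ℕ) (hloK : lo < K) (hK4 : K ≤ 4 * lo) {x : ℝ} (hx0 : 0 < x) (L : List Sib)
    (hL : ∀ s ∈ L, s.M = lo + K ∧ 0 < s.q ∧ s.q < 1 ∧ ∃ g : ℝ, 0 < g ∧ g < 1 ∧ s.ρ = SP[lo, K, g] ∧ x ≤ s.q * g)
    (hfew : (L.filter (fun s => decide (2 * (lo : ℝ) < s.q * s.mean ∧ s.q * s.mean < (lo : ℝ) + K * x))).length ≤ 3) :
    SDEC x (ftop L) (flaw L) := by
  have hlo : 1 ≤ lo := by omega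
  refine sdec_shapeForests_of_tightCore lo K hlo hx0 L hL (sdec_shapeForest_long lo K hloK hK4 hx0 _ hfew fun s hs => ?_)
  have ht : 2 * (lo : ℝ) < s.q * s.mean ∧ s.q * s.mean < (lo : ℝ) + K * x := by
    have hb := (List.mem_filter.1 hs).2
    simpa using hb
  obtain ⟨hM, hq0, hq1, g, hg0, hg1, hρ, hx⟩ := hL s (List.mem_of_mem_filter hs)
  obtain ⟨_, _, _, cm⟩ := sp_laws lo K hg0.le hg1.le
  have hmean : s.mean = (lo : ℝ) + K * g := by unfold Sib.mean; rw [hM, hρ]; exact cm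
  exact ⟨hM, hq0, hq1, g, hg0, hg1, hρ, by rw [← hmean]; exact ht.1.le, hx⟩

/-! ### The node-shaped form -/

/-- **THE SIBLING STEP FOR EVERY FOREST WHOSE HARD CORE IS THE TIGHT PART OF A ONE-SHAPE FAMILY OF GLUED SIBLINGS — NO ORACLE.**  For `0 < x < 1`,
`lo, K ≥ 1`, any list `Lg` of siblings GOOD at `x` (law-OK, `x·M ≤ q·mean`, tame or hull+high — any sub-trees), any list `Lc` of glued siblings
`⟨q,·,·,lo+K,{lo: 1−g, lo+K: g}⟩` (`0 < q, g < 1`, `x ≤ qg`) whose tight part `Lc.filter (2lo < q·mean < lo + K·x)` has length `≤ 1`, or `≤ 3` with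
`lo < K ≤ 4lo`, or any length with `lo < K ≤ 2lo`, and every forest `L ~ Lg ++ Lc`: `SDEC x (ftop L) (flaw L)`. [this work] -/
theorem sdec_forest_tightCore (lo K : ℕ) (hlo : 1 ≤ lo) (hK : 1 ≤ K) {x : ℝ} (hx0 : 0 < x) (hx1 : x < 1) (Lg Lc L : List Sib)
    (hLg : ∀ s ∈ Lg, s.LawOK ∧ x * (s.M : ℝ) ≤ s.q * s.mean ∧
      ((∀ h : ℕ, 1 ≤ h → s.ρ h ≠ 0 → s.q * s.mean ≤ 2 * h ∨ x * ((s.M : ℝ) - h) ≤ s.q * s.mean - h) ∨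
        HullHigh x (s.q * s.mean) s.M (gate s.ρ s.q)))
    (hLc : ∀ s ∈ Lc, s.M = lo + K ∧ 0 < s.q ∧ s.q < 1 ∧ ∃ g : ℝ, 0 < g ∧ g < 1 ∧ s.ρ = SP[lo, K, g] ∧ x ≤ s.q * g)
    (hcore : (Lc.filter (fun s => decide (2 * (lo : ℝ) < s.q * s.mean ∧ s.q * s.mean < (lo : ℝ) + K * x))).length ≤ 1 ∨
      (lo < K ∧ K ≤ 4 * lo ∧ (Lc.filter (fun s => decide (2 * (lo : ℝ) < s.q * s.mean ∧ s.q * s.mean < (lo : ℝ) + K * x))).length ≤ 3) ∨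
      (lo < K ∧ K ≤ 2 * lo))
    (hperm : (Lg ++ Lc).Perm L) :
    SDEC x (ftop L) (flaw L) := by
  have fc : ∀ s ∈ Lc, s.LawOK ∧ x * (s.M : ℝ) ≤ s.q * s.mean := fun s hs =>
    ⟨(shapeSib_facts lo K hlo s (hLc s hs)).1, (shapeSib_facts lo K hlo s (hLc s hs)).2.1⟩
  have hSc : SDEC x (ftop Lc) (flaw Lc) := by
    rcases hcore with h1 | ⟨hloK, hK4, h3⟩ | ⟨hloK, hK2⟩
    · exact sdec_shapeForests_of_oneTight lo K hlo hK hx0 Lc hLc h1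
    · exact sdec_shapeForests_long_of_fewTight lo K hloK hK4 hx0 Lc hLc h3
    · exact sdec_shapeForests_all_twoLo lo K hloK hK2 hx0 Lc hLc
  refine sdec_flaw_perm hperm ?_
  exact sdec_append_good hx0 hx1 Lc (fun t ht => (fc t ht).1) (fun t ht => (fc t ht).2) hSc Lg (fun s hs => (hLg s hs).1)
    (fun s hs => (hLg s hs).2.1) (fun s hs => (hLg s hs).2.2)

end LawDec
end Quant
end Summit.CriticalPhenomena.PercolationContinuityZ3.Theorems
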